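import Summits.Parity.GeneralizedHardyLittlewood.Theorems.PrimeLevelFamEdgeMomentsBeyondDiagonalDiagDecorPrimeSq
import Summits.Parity.GeneralizedHardyLittlewood.Theorems.PrimeLevelFamEdgeMomentsBeyondDiagonalDiagDecorLogPow
import Summits.Parity.GeneralizedHardyLittlewood.Theorems.PrimeLevelFamEdgeMomentsBeyondDiagonalDiagDecorTau2
import HarnessLib

/-!
# Route `PrimeLevelFamEdge`, crux K_A `MomentsBeyondDiagonal` (stmt-Parity-20007), line «petersson_layers» v4, stub `stub_diag`:
# **the `τ_{1,0}`-, `τ_{1,1}`- and `τ_{2,0}`-decorated coprime Selberg sums (the `k`-sums of rung `N = 1` and of the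
# orders `(2,0)`, `(0,2)`):**
# `Σ_{k≤y,(k,n)=1} W(k)τ_{1,0}(k)logᶜ(y/k) = −c·E_n log^{c−1}y + O`, `Σ W τ_{1,1} logᶜ = E_n logᶜy + O`, `Σ W τ_{2,0} logᶜ = 0·logᶜy + O`

Census R3(ii), ANALYTIC HALF. In the decorated Selberg coordinates of `…DiagOrderSelberg` (p821962) the inner
`Σ_{d∣k₁}Σ_{e∣k₂}` of a monomial log-decoration factors into generalised divisor sums
`τ_{α,β}(k) = Σ_{d∣k}(log d)^α(log(k/d))^β` of `k₁` and of `k₂`, weighted by `W(k)[(k,n)=1]` (`W = μ/(id·ψ)`, so only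
squarefree `k` count). With `τ_{1,0} = ½τ·log` (`…DiagDecorTools.sum_divisors_log_eq`), `τ_{1,1} = τ(log² − P₂)/4`
(`…DiagDecorMult.tau11_eq_of_squarefree`), `τ_{2,0} = τ(log² + P₂)/4` (`…DiagDecorTau2.tau20_eq_of_squarefree`) and the two
decorated engines `Σ a_n(k)log²k·logᶜ(y/k) = 2E_n logᶜy + O` (`…DiagDecorLogPow`), `Σ a_n(k)P₂(k)logᶜ(y/k) = −2E_n logᶜy + O`
(`…DiagDecorPrimeSq`), `a_n = copTauW n = τ·W·[(·,n)=1]`: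

* `copW_mul_tau10_eq`, `copW_mul_tau11_eq`, `copW_mul_tau20_eq` — termwise: `W(k)[(k,n)=1]·τ_{1,0}(k) = a_n(k)·log k/2`,
  `W(k)[(k,n)=1]·τ_{1,1}(k) = a_n(k)(log²k − P₂(k))/4`, `W(k)[(k,n)=1]·τ_{2,0}(k) = a_n(k)(log²k + P₂(k))/4` (every `k ≥ 1`;
  `W = 0` off the squarefree numbers);
* `abs_copW_tau10_sum_add_le` — **`|Σ_{k≤y} W(k)[(k,n)=1]τ_{1,0}(k)logᶜ(y/k) + c·E_n log^{c−1}y| ≤ C·D(n)(1+log y)^{c−2}`**;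
* `abs_copW_tau11_sum_sub_le` — **`|Σ_{k≤y} W(k)[(k,n)=1]τ_{1,1}(k)logᶜ(y/k) − E_n logᶜy| ≤ C·D(n)(1+κ(n))(1+log y)^{c−1}`**;
* `abs_copW_tau20_sum_le` — **`|Σ_{k≤y} W(k)[(k,n)=1]τ_{2,0}(k)logᶜ(y/k)| ≤ C·D(n)(1+κ(n))(1+log y)^{c−1}`** (the naive
  leading term `logᶜy` CANCELS: the order-`(2,0)` decoration contributes one log below its degree),
all for `c ≥ 2`, `n ≥ 1`, `y ≥ 1`. These are the `k`-sum inputs (before the profile layer `Σ_c P_c/logᶜM` of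
`…DiagProfileCoord` type and the `(c,g) ↦ n` collapse) of the per-order targets `(1,1)`, `(2,0)`, `(0,2)` of
`subDiag_of_selbergOrderAsymptotics`. Def-free; theorems only. Helper `--supports stmt-Parity-20007`; closes nothing;
K_A, K_B and the Parity summit are NOT proved; nothing about Landau–Siegel zeros.

## References
* E. Kowalski, P. Michel, J. VanderKam, J. reine angew. Math. 526 (2000), (23)–(28) pp. 13–15 and Prop. 5.1 p. 18
  (the residue evaluation of the diagonal main term; here the log-decorations of a general `Q` in real variables).
  [cite: KowalskiMichelVanderKam2000, (23)–(28) — derivation (divisor-log decorations of the Selberg coordinates)]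
-/

noncomputable section

open scoped Real
open Finset ArithmeticFunction

namespace Summit.Parity.GeneralizedHardyLittlewood.Theorems.MomentsBeyondDiagonal.DiagKernel

open Literature.NumberTheory.LFunctions Literature.NumberTheory.LFunctions.KMV2000
open MollifierMainTerm (W)
open SelbergCoord (kappa)
open Summit.Parity.GeneralizedHardyLittlewood.Theorems.BeyondDiagonalBeatsQuarter.KernelFormXSq
  (copTauW copTauW_apply mainConst divWeight divWeight_nonneg mainConst_nonneg W_eq_zero_of_not_squarefree)
open Summit.Parity.GeneralizedHardyLittlewood.Theorems.MomentsBeyondDiagonal.DiagLines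
  (sum_divisors_log_eq tau11_eq_of_squarefree tau20_eq_of_squarefree)

/-! ### Termwise identities -/

/-- `W(k)[(k,n)=1]·τ_{1,0}(k) = a_n(k)·log k/2` for `k ≥ 1` (`τ_{1,0}(k) = Σ_{d∣k}log d = ½τ(k)log k`). [folklore] -/
theorem copW_mul_tau10_eq (n : ℕ) {k : ℕ} (hk : k ≠ 0) :
    (if k.Coprime n then W k else 0) * ∑ d ∈ k.divisors, Real.log d = copTauW n k * (Real.log k / 2) := by
  rw [copTauW_apply, sum_divisors_log_eq hk]
  split_ifs <;> ring

/-- `W(k)[(k,n)=1]·τ_{1,1}(k) = a_n(k)·(log²k − P₂(k))/4` (`tau11_eq_of_squarefree` on squarefree `k`,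
`W(k) = 0` otherwise). [folklore] -/
theorem copW_mul_tau11_eq (n k : ℕ) :
    (if k.Coprime n then W k else 0) * ∑ d ∈ k.divisors, Real.log d * Real.log ((k / d : ℕ) : ℝ) =
      copTauW n k * ((Real.log k ^ 2 - ∑ p ∈ k.primeFactors, Real.log p ^ 2) / 4) := by
  rw [copTauW_apply]
  by_cases hsq : Squarefree k
  · rw [tau11_eq_of_squarefree hsq]
    split_ifs <;> ring
  · rw [W_eq_zero_of_not_squarefree hsq]
    split_ifs <;> simp

/-- `W(k)[(k,n)=1]·τ_{2,0}(k) = a_n(k)·(log²k + P₂(k))/4` (`tau20_eq_of_squarefree` on squarefree `k`,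
`W(k) = 0` otherwise). [folklore] -/
theorem copW_mul_tau20_eq (n k : ℕ) :
    (if k.Coprime n then W k else 0) * ∑ d ∈ k.divisors, Real.log d ^ 2 =
      copTauW n k * ((Real.log k ^ 2 + ∑ p ∈ k.primeFactors, Real.log p ^ 2) / 4) := by
  rw [copTauW_apply]
  by_cases hsq : Squarefree k
  · rw [tau20_eq_of_squarefree hsq]
    split_ifs <;> ring
  · rw [W_eq_zero_of_not_squarefree hsq]
    split_ifs <;> simp

/-! ### The three decorated `k`-sums -/

/-- **The `τ_{1,0}`-decorated coprime Selberg sum**: for `c ≥ 2` there is `C` with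
`|Σ_{k≤y} W(k)[(k,n)=1]·τ_{1,0}(k)·logᶜ(y/k) + c·E_n·log^{c−1}y| ≤ C·D(n)(1+log y)^{c−2}` (`n ≥ 1`, `y ≥ 1`).
[cite: KowalskiMichelVanderKam2000, (23)–(28) and Prop. 5.1 — derivation] -/
theorem abs_copW_tau10_sum_add_le {c : ℕ} (hc : 2 ≤ c) :
    ∃ C : ℝ, 0 < C ∧ ∀ n : ℕ, n ≠ 0 → ∀ y : ℝ, 1 ≤ y →
      |∑ k ∈ Icc 1 ⌊y⌋₊, (if k.Coprime n then W k else 0) * (∑ d ∈ k.divisors, Real.log d) * Real.log (y / k) ^ c +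
          (c : ℝ) * mainConst n * Real.log y ^ (c - 1)| ≤ C * divWeight n * (1 + Real.log y) ^ (c - 2) := by
  obtain ⟨C, hC, h⟩ := abs_coprimeSumPow_log_sub_le hc
  refine ⟨C / 2, by positivity, fun n hn y hy ↦ ?_⟩
  have hterm : ∀ k ∈ Icc 1 ⌊y⌋₊,
      (if k.Coprime n then W k else 0) * (∑ d ∈ k.divisors, Real.log d) * Real.log (y / k) ^ c =
        (1 / 2) * (copTauW n k * Real.log k * Real.log (y / k) ^ c) := by
    intro k hk
    have hk0 : k ≠ 0 := by have := (Finset.mem_Icc.1 hk).1; omega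
    rw [copW_mul_tau10_eq n hk0]; ring
  rw [Finset.sum_congr rfl hterm, ← Finset.mul_sum]
  have h' := h n hn y hy
  have e : (1 / 2) * (∑ k ∈ Icc 1 ⌊y⌋₊, copTauW n k * Real.log k * Real.log (y / k) ^ c) +
      (c : ℝ) * mainConst n * Real.log y ^ (c - 1) =
      (1 / 2) * (∑ k ∈ Icc 1 ⌊y⌋₊, copTauW n k * Real.log k * Real.log (y / k) ^ c +
        2 * (c : ℝ) * mainConst n * Real.log y ^ (c - 1)) := by ring
  rw [e, abs_mul, abs_of_pos (by norm_num : (0 : ℝ) < 1 / 2)]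
  calc 1 / 2 * |∑ k ∈ Icc 1 ⌊y⌋₊, copTauW n k * Real.log k * Real.log (y / k) ^ c +
        2 * (c : ℝ) * mainConst n * Real.log y ^ (c - 1)|
      ≤ 1 / 2 * (C * divWeight n * (1 + Real.log y) ^ (c - 2)) := by gcongr
    _ = C / 2 * divWeight n * (1 + Real.log y) ^ (c - 2) := by ring

/-- **The `τ_{1,1}`-decorated coprime Selberg sum**: for `c ≥ 2` there is `C` with
`|Σ_{k≤y} W(k)[(k,n)=1]·τ_{1,1}(k)·logᶜ(y/k) − E_n·logᶜy| ≤ C·D(n)(1+κ(n))(1+log y)^{c−1}` (`n ≥ 1`, `y ≥ 1`):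
`¼[(2E_n logᶜy) − (−2E_n logᶜy)] = E_n logᶜy`. [cite: KowalskiMichelVanderKam2000, (23)–(28) and Prop. 5.1 — derivation] -/
theorem abs_copW_tau11_sum_sub_le {c : ℕ} (hc : 2 ≤ c) :
    ∃ C : ℝ, 0 < C ∧ ∀ n : ℕ, n ≠ 0 → ∀ y : ℝ, 1 ≤ y →
      |∑ k ∈ Icc 1 ⌊y⌋₊, (if k.Coprime n then W k else 0) *
            (∑ d ∈ k.divisors, Real.log d * Real.log ((k / d : ℕ) : ℝ)) * Real.log (y / k) ^ c -
          mainConst n * Real.log y ^ c| ≤ C * divWeight n * (1 + kappa n) * (1 + Real.log y) ^ (c - 1) := by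
  obtain ⟨C₁, hC₁, h1⟩ := abs_coprimeSumPow_logSq_sub_le hc
  -- the prime-square engine, in one format for `c = 2` and `c ≥ 3`
  have h2ex : ∃ C₂ : ℝ, 0 < C₂ ∧ ∀ n : ℕ, n ≠ 0 → ∀ y : ℝ, 1 ≤ y →
      |∑ k ∈ Icc 1 ⌊y⌋₊, copTauW n k * Real.log (y / k) ^ c * ∑ p ∈ k.primeFactors, Real.log p ^ 2 +
          2 * mainConst n * Real.log y ^ c| ≤ C₂ * divWeight n * (1 + kappa n) * (1 + Real.log y) ^ (c - 1) := by
    rcases Nat.lt_or_ge c 3 with h3 | h3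
    · have hc2 : c = 2 := by omega
      subst hc2
      simpa using abs_coprimeSum_primeSq_add_le
    · exact abs_coprimeSumPow_primeSq_add_le h3
  obtain ⟨C₂, hC₂, h2⟩ := h2ex
  refine ⟨(C₁ + C₂) / 4, by positivity, fun n hn y hy ↦ ?_⟩
  have hly : 0 ≤ Real.log y := Real.log_nonneg hy
  have hD := divWeight_nonneg n
  have hκ : 0 ≤ kappa n := by
    unfold kappa
    exact Finset.sum_nonneg fun p hp ↦ by
      have hp2 : (2 : ℝ) ≤ p := by exact_mod_cast (Nat.prime_of_mem_primeFactors hp).two_le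
      exact div_nonneg (Real.log_nonneg (by linarith)) (by linarith)
  have hterm : ∀ k ∈ Icc 1 ⌊y⌋₊,
      (if k.Coprime n then W k else 0) * (∑ d ∈ k.divisors, Real.log d * Real.log ((k / d : ℕ) : ℝ)) *
          Real.log (y / k) ^ c =
        (1 / 4) * (copTauW n k * Real.log k ^ 2 * Real.log (y / k) ^ c -
          copTauW n k * Real.log (y / k) ^ c * ∑ p ∈ k.primeFactors, Real.log p ^ 2) := by
    intro k _
    rw [copW_mul_tau11_eq n k]; ring
  rw [Finset.sum_congr rfl hterm, ← Finset.mul_sum, Finset.sum_sub_distrib]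
  set A := ∑ k ∈ Icc 1 ⌊y⌋₊, copTauW n k * Real.log k ^ 2 * Real.log (y / k) ^ c with hA
  set B := ∑ k ∈ Icc 1 ⌊y⌋₊, copTauW n k * Real.log (y / k) ^ c * ∑ p ∈ k.primeFactors, Real.log p ^ 2 with hB
  have hA' := h1 n hn y hy
  have hB' := h2 n hn y hy
  rw [← hA] at hA'
  rw [← hB] at hB'
  have e : (1 / 4) * (A - B) - mainConst n * Real.log y ^ c =
      (1 / 4) * ((A - 2 * mainConst n * Real.log y ^ c) - (B + 2 * mainConst n * Real.log y ^ c)) := by ring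
  rw [e, abs_mul, abs_of_pos (by norm_num : (0 : ℝ) < 1 / 4)]
  have hpow : (1 + Real.log y) ^ (c - 1) * 1 ≤ (1 + Real.log y) ^ (c - 1) * (1 + kappa n) :=
    mul_le_mul_of_nonneg_left (by linarith) (by positivity)
  calc 1 / 4 * |(A - 2 * mainConst n * Real.log y ^ c) - (B + 2 * mainConst n * Real.log y ^ c)|
      ≤ 1 / 4 * (|A - 2 * mainConst n * Real.log y ^ c| + |B + 2 * mainConst n * Real.log y ^ c|) := by
        gcongr; exact abs_sub _ _
    _ ≤ 1 / 4 * (C₁ * divWeight n * (1 + Real.log y) ^ (c - 1) +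
        C₂ * divWeight n * (1 + kappa n) * (1 + Real.log y) ^ (c - 1)) := by gcongr
    _ ≤ 1 / 4 * (C₁ * divWeight n * (1 + kappa n) * (1 + Real.log y) ^ (c - 1) +
        C₂ * divWeight n * (1 + kappa n) * (1 + Real.log y) ^ (c - 1)) := by
        have : C₁ * divWeight n * (1 + Real.log y) ^ (c - 1) ≤ C₁ * divWeight n * (1 + kappa n) * (1 + Real.log y) ^ (c - 1) := by
          calc C₁ * divWeight n * (1 + Real.log y) ^ (c - 1) = C₁ * divWeight n * ((1 + Real.log y) ^ (c - 1) * 1) := by ring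
            _ ≤ C₁ * divWeight n * ((1 + Real.log y) ^ (c - 1) * (1 + kappa n)) :=
                mul_le_mul_of_nonneg_left hpow (by positivity)
            _ = _ := by ring
        linarith
    _ = (C₁ + C₂) / 4 * divWeight n * (1 + kappa n) * (1 + Real.log y) ^ (c - 1) := by ring

/-- **The `τ_{2,0}`-decorated coprime Selberg sum**: for `c ≥ 2` there is `C` with
`|Σ_{k≤y} W(k)[(k,n)=1]·τ_{2,0}(k)·logᶜ(y/k)| ≤ C·D(n)(1+κ(n))(1+log y)^{c−1}` (`n ≥ 1`, `y ≥ 1`): the naive leading term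
`¼[(2E_n logᶜy) + (−2E_n logᶜy)]` vanishes. [cite: KowalskiMichelVanderKam2000, (23)–(28) and Prop. 5.1 — derivation] -/
theorem abs_copW_tau20_sum_le {c : ℕ} (hc : 2 ≤ c) :
    ∃ C : ℝ, 0 < C ∧ ∀ n : ℕ, n ≠ 0 → ∀ y : ℝ, 1 ≤ y →
      |∑ k ∈ Icc 1 ⌊y⌋₊, (if k.Coprime n then W k else 0) * (∑ d ∈ k.divisors, Real.log d ^ 2) *
          Real.log (y / k) ^ c| ≤ C * divWeight n * (1 + kappa n) * (1 + Real.log y) ^ (c - 1) := by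
  obtain ⟨C₁, hC₁, h1⟩ := abs_coprimeSumPow_logSq_sub_le hc
  have h2ex : ∃ C₂ : ℝ, 0 < C₂ ∧ ∀ n : ℕ, n ≠ 0 → ∀ y : ℝ, 1 ≤ y →
      |∑ k ∈ Icc 1 ⌊y⌋₊, copTauW n k * Real.log (y / k) ^ c * ∑ p ∈ k.primeFactors, Real.log p ^ 2 +
          2 * mainConst n * Real.log y ^ c| ≤ C₂ * divWeight n * (1 + kappa n) * (1 + Real.log y) ^ (c - 1) := by
    rcases Nat.lt_or_ge c 3 with h3 | h3
    · have hc2 : c = 2 := by omega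
      subst hc2
      simpa using abs_coprimeSum_primeSq_add_le
    · exact abs_coprimeSumPow_primeSq_add_le h3
  obtain ⟨C₂, hC₂, h2⟩ := h2ex
  refine ⟨(C₁ + C₂) / 4, by positivity, fun n hn y hy ↦ ?_⟩
  have hly : 0 ≤ Real.log y := Real.log_nonneg hy
  have hD := divWeight_nonneg n
  have hκ : 0 ≤ kappa n := by
    unfold kappa
    exact Finset.sum_nonneg fun p hp ↦ by
      have hp2 : (2 : ℝ) ≤ p := by exact_mod_cast (Nat.prime_of_mem_primeFactors hp).two_le
      exact div_nonneg (Real.log_nonneg (by linarith)) (by linarith)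
  have hterm : ∀ k ∈ Icc 1 ⌊y⌋₊,
      (if k.Coprime n then W k else 0) * (∑ d ∈ k.divisors, Real.log d ^ 2) * Real.log (y / k) ^ c =
        (1 / 4) * (copTauW n k * Real.log k ^ 2 * Real.log (y / k) ^ c +
          copTauW n k * Real.log (y / k) ^ c * ∑ p ∈ k.primeFactors, Real.log p ^ 2) := by
    intro k _
    rw [copW_mul_tau20_eq n k]; ring
  rw [Finset.sum_congr rfl hterm, ← Finset.mul_sum, Finset.sum_add_distrib]
  set A := ∑ k ∈ Icc 1 ⌊y⌋₊, copTauW n k * Real.log k ^ 2 * Real.log (y / k) ^ c with hA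
  set B := ∑ k ∈ Icc 1 ⌊y⌋₊, copTauW n k * Real.log (y / k) ^ c * ∑ p ∈ k.primeFactors, Real.log p ^ 2 with hB
  have hA' := h1 n hn y hy
  have hB' := h2 n hn y hy
  rw [← hA] at hA'
  rw [← hB] at hB'
  have e : (1 / 4) * (A + B) =
      (1 / 4) * ((A - 2 * mainConst n * Real.log y ^ c) + (B + 2 * mainConst n * Real.log y ^ c)) := by ring
  rw [e, abs_mul, abs_of_pos (by norm_num : (0 : ℝ) < 1 / 4)]
  have hpow : (1 + Real.log y) ^ (c - 1) * 1 ≤ (1 + Real.log y) ^ (c - 1) * (1 + kappa n) :=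
    mul_le_mul_of_nonneg_left (by linarith) (by positivity)
  calc 1 / 4 * |(A - 2 * mainConst n * Real.log y ^ c) + (B + 2 * mainConst n * Real.log y ^ c)|
      ≤ 1 / 4 * (|A - 2 * mainConst n * Real.log y ^ c| + |B + 2 * mainConst n * Real.log y ^ c|) := by
        gcongr; exact abs_add_le _ _
    _ ≤ 1 / 4 * (C₁ * divWeight n * (1 + Real.log y) ^ (c - 1) +
        C₂ * divWeight n * (1 + kappa n) * (1 + Real.log y) ^ (c - 1)) := by gcongr
    _ ≤ 1 / 4 * (C₁ * divWeight n * (1 + kappa n) * (1 + Real.log y) ^ (c - 1) +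
        C₂ * divWeight n * (1 + kappa n) * (1 + Real.log y) ^ (c - 1)) := by
        have : C₁ * divWeight n * (1 + Real.log y) ^ (c - 1) ≤ C₁ * divWeight n * (1 + kappa n) * (1 + Real.log y) ^ (c - 1) := by
          calc C₁ * divWeight n * (1 + Real.log y) ^ (c - 1) = C₁ * divWeight n * ((1 + Real.log y) ^ (c - 1) * 1) := by ring
            _ ≤ C₁ * divWeight n * ((1 + Real.log y) ^ (c - 1) * (1 + kappa n)) :=
                mul_le_mul_of_nonneg_left hpow (by positivity)
            _ = _ := by ring
        linarith
    _ = (C₁ + C₂) / 4 * divWeight n * (1 + kappa n) * (1 + Real.log y) ^ (c - 1) := by ring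

end Summit.Parity.GeneralizedHardyLittlewood.Theorems.MomentsBeyondDiagonal.DiagKernel

end
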